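import Summits.Ventures.HSemireg.WedgeHankelRecurrenceGaussHermiteElectrostatic

/-!
# Venture HSemireg — **THE LAGUERRE STRUCTURE RELATION, DIFFERENTIAL EQUATION AND STIELTJES' EQUILIBRIUM** from the recurrence alone: for the monic Laguerre recurrence `a_n = 2n + 1 + α`,
# `b_{n+1} = (n+1)(n+1+α)`: **`X · L_{n+1}' = (n+1) L_{n+1} + (n+1)(n+1+α) L_n`** (two-step induction), hence **`X L_n'' + (α + 1 − X) L_n' + n L_n = 0`**, and at the zeros `0 < x_0 < ⋯ < x_t` of
# `L_{t+1}` (`α > −1`, N376) **`Σ_{j ≠ k} 1∕(x_k − x_j) = (x_k − α − 1)∕(2 x_k)`** — `t + 1` unit charges in equilibrium with a charge `(α+1)∕2` at the origin and a constant field (Stieltjes 1885)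

HONEST FRAMING. Part of the Lean index of the computation cell `pub-hsemireg` (seat p10 gen 46, Sunday typer «UNIFORM-IN-n»).  Real polynomials, derivatives and finite sums only; no variety, no
cohomology theory, no sheaf, no Ext group and no semiregularity map is constructed here; nothing here says that HC / HC_CM / HC_AV holds; no Literature fact (unproved `Prop`) is declared or used.
Custodian versions as in `WedgeHankelSiegelIdeal` (1/3).
SOURCES (cited).  G. Szegő, *Orthogonal Polynomials*, (5.1.2) (Laguerre's equation `x y'' + (α + 1 − x) y' + n y = 0`), (5.1.14) (`x L_n' = n L_n − (n+α) L_{n−1}`, classical normalisation), §6.7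
Thm 6.7.2 (the Laguerre case of Stieltjes' problem, (6.7.5)–(6.7.6)); T. J. Stieltjes, *Sur les polynômes de Jacobi*, C. R. Acad. Sci. 100 (1885) 620–622; M. E. H. Ismail, *Classical and Quantum
Orthogonal Polynomials* (2005), §3.5, (4.6.x).
PROOF TYPED HERE.  The structure relation by the pair induction `(★)_n, (★)_{n+1} ⇒ (★)_{n+2}`, eliminating `L_n` through the recurrence (pure `ℝ[X]` algebra, `linear_combination`); the
differential equation: `X ·` (equation for `L_{n+2}`) is the combination `X·∂(★)_{n+2} + (n + 2 + α − X)·(★)_{n+2} + c·(★)_{n+1} + c·(recurrence)` with `c = (n+2)(n+2+α)`, then cancel `X`;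
Stieltjes' identity from N388 `sum_inv_sub_nodes_eq` (`2 f' Σ = f''`) and the equation at a zero (`x L'' = (x − α − 1) L'`).
DEDUP DISCLOSURE (`rg -n -i 'laguerre_structure|laguerre_differential|laguerre_zeros_electro' Summits/Ventures/HSemireg`, 2026-09-03): N376 ∕ N380 (Laguerre recurrence data, `L^{(α)} → L^{(α+1)}`),
N388 (Hermite); nothing on Laguerre's equation.  The 3 names below: 0 hits tree-wide.

WHAT IS IN THE TREE.  N376 `laguerre_zeros`; N388 `sum_inv_sub_nodes_eq`; N284 `eval_derivative_prod_X_sub_C_at_node`; Mathlib `Polynomial.derivative_mul`, `Polynomial.X_ne_zero`.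
THIS FILE (namespace `Summit.Ventures.HSemireg.Wedge.HankelOuter` continued; CHAINED on N388 (import); 0 definitions):
* §1154 **`laguerre_structure_relation`**, **`laguerre_differential_equation`**, **`laguerre_zeros_electrostatic`**.
CAVEATS.  Monic normalisation; the Laguerre family enters through its recurrence only.  Nothing Ext-side.  New names only.
-/

open Module Polynomial
open scoped Matrix Polynomial

namespace Summit.Ventures.HSemireg.Wedge.HankelOuter

/-! ## §1154. Laguerre: structure relation, differential equation, electrostatics -/

/-- **THE STRUCTURE RELATION: `X · L_{n+1}' = (n+1) L_{n+1} + (n+1)(n+1+α) L_n`** for the monic Laguerre recurrence. [Szegő (5.1.14); this file, §1154] -/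
theorem laguerre_structure_relation {L : ℕ → ℝ[X]} {a b : ℕ → ℝ} {α : ℝ} (hL0 : L 0 = 1) (hL1 : L 1 = Polynomial.X - C (a 0))
    (hLrec : ∀ n, L (n + 2) = (Polynomial.X - C (a (n + 1))) * L (n + 1) - C (b (n + 1)) * L n) (ha : ∀ n, a n = 2 * n + 1 + α)
    (hb : ∀ n, b (n + 1) = ((n : ℝ) + 1) * ((n : ℝ) + 1 + α)) (n : ℕ) :
    Polynomial.X * derivative (L (n + 1)) = C ((n : ℝ) + 1) * L (n + 1) + C (((n : ℝ) + 1) * ((n : ℝ) + 1 + α)) * L n := by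
  -- recurrence with the data substituted and `C` expanded
  have hrec : ∀ m, L (m + 2) = (Polynomial.X - (2 * (m : ℝ[X]) + 3 + C α)) * L (m + 1) - (((m : ℝ[X]) + 1) * ((m : ℝ[X]) + 1 + C α)) * L m := fun m => by
    rw [hLrec m, ha, hb]
    simp only [map_add, map_mul, map_one, map_natCast, map_ofNat, Nat.cast_add, Nat.cast_one]
    ring
  have key : ∀ n, Polynomial.X * derivative (L (n + 1)) = ((n : ℝ[X]) + 1) * L (n + 1) + (((n : ℝ[X]) + 1) * ((n : ℝ[X]) + 1 + C α)) * L n ∧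
      Polynomial.X * derivative (L (n + 2)) = ((n : ℝ[X]) + 2) * L (n + 2) + (((n : ℝ[X]) + 2) * ((n : ℝ[X]) + 2 + C α)) * L (n + 1) := by
    intro n
    induction n with
    | zero =>
      have h1 : L 1 = Polynomial.X - (1 + C α) := by rw [hL1, ha, Nat.cast_zero, mul_zero, zero_add, map_add, map_one]
      have h2 := hrec 0
      constructor
      · rw [h1, hL0, derivative_sub, derivative_X, derivative_add, derivative_one, derivative_C]; push_cast; ring
      · rw [h2, h1, hL0]
        simp only [Nat.cast_zero, mul_zero, zero_add, derivative_sub, derivative_mul, derivative_X, derivative_add, derivative_one, derivative_C, derivative_ofNat]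
        ring
    | succ n ih =>
      obtain ⟨e0, e1⟩ := ih
      refine ⟨by rw [show n + 1 + 1 = n + 2 from rfl]; push_cast; rw [show (n : ℝ[X]) + 1 + 1 = (n : ℝ[X]) + 2 by ring]; exact e1, ?_⟩
      have h3 := hrec (n + 1)
      rw [show n + 1 + 2 = n + 3 from rfl] at h3
      rw [show n + 1 + 2 = n + 3 from rfl, show n + 1 + 1 = n + 2 from rfl]
      -- differentiate the recurrence for `L_{n+3}`
      have hd : derivative (L (n + 3)) = L (n + 2) + (Polynomial.X - (2 * ((n + 1 : ℕ) : ℝ[X]) + 3 + C α)) * derivative (L (n + 2)) -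
          ((((n + 1 : ℕ) : ℝ[X])) + 1) * ((((n + 1 : ℕ) : ℝ[X])) + 1 + C α) * derivative (L (n + 1)) := by
        rw [h3]
        simp only [derivative_sub, derivative_mul, derivative_X, derivative_add, derivative_C, derivative_ofNat, derivative_natCast, derivative_one]
        ring
      have h2 := hrec n
      push_cast at hd h3 ⊢
      rw [hd, h3]
      linear_combination (Polynomial.X - (2 * (n : ℝ[X]) + 5 + C α)) * e1 - (((n : ℝ[X]) + 2) * ((n : ℝ[X]) + 2 + C α)) * e0 -
        (((n : ℝ[X]) + 2) * ((n : ℝ[X]) + 2 + C α)) * h2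
  have h := (key n).1
  simp only [map_add, map_mul, map_one, map_natCast]
  exact h

/-- **LAGUERRE'S DIFFERENTIAL EQUATION: `X L_n'' + (α + 1 − X) L_n' + n L_n = 0`.** [Szegő (5.1.2); this file, §1154] -/
theorem laguerre_differential_equation {L : ℕ → ℝ[X]} {a b : ℕ → ℝ} {α : ℝ} (hL0 : L 0 = 1) (hL1 : L 1 = Polynomial.X - C (a 0))
    (hLrec : ∀ n, L (n + 2) = (Polynomial.X - C (a (n + 1))) * L (n + 1) - C (b (n + 1)) * L n) (ha : ∀ n, a n = 2 * n + 1 + α)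
    (hb : ∀ n, b (n + 1) = ((n : ℝ) + 1) * ((n : ℝ) + 1 + α)) (n : ℕ) :
    Polynomial.X * derivative (derivative (L n)) + (C (α + 1) - Polynomial.X) * derivative (L n) + C (n : ℝ) * L n = 0 := by
  have hstar : ∀ m, Polynomial.X * derivative (L (m + 1)) = ((m : ℝ[X]) + 1) * L (m + 1) + (((m : ℝ[X]) + 1) * ((m : ℝ[X]) + 1 + C α)) * L m := fun m => by
    have h := laguerre_structure_relation hL0 hL1 hLrec ha hb m
    simp only [map_add, map_mul, map_one, map_natCast] at h
    exact h
  have hrec : ∀ m, L (m + 2) = (Polynomial.X - (2 * (m : ℝ[X]) + 3 + C α)) * L (m + 1) - (((m : ℝ[X]) + 1) * ((m : ℝ[X]) + 1 + C α)) * L m := fun m => by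
    rw [hLrec m, ha, hb]
    simp only [map_add, map_mul, map_one, map_natCast, map_ofNat, Nat.cast_add, Nat.cast_one]
    ring
  simp only [map_add, map_one, map_natCast]
  rcases n with _ | n
  · rw [hL0]; simp
  rcases n with _ | n
  · have h1 : L 1 = Polynomial.X - (1 + C α) := by rw [hL1, ha, Nat.cast_zero, mul_zero, zero_add, map_add, map_one]
    rw [h1]
    simp only [derivative_sub, derivative_X, derivative_add, derivative_one, derivative_C, derivative_zero]
    push_cast; ring
  · -- `L_{n+2}`: cancel `X` from the combination
    have e0 := hstar (n + 1)
    have e2 := hstar n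
    have e3 := hrec n
    rw [show n + 1 + 1 = n + 2 from rfl] at e0
    have e1 : derivative (Polynomial.X * derivative (L (n + 2))) = derivative ((((n + 1 : ℕ) : ℝ[X]) + 1) * L (n + 2) + ((((n + 1 : ℕ) : ℝ[X]) + 1) * (((n + 1 : ℕ) : ℝ[X]) + 1 + C α)) * L (n + 1)) :=
      congrArg derivative e0
    simp only [derivative_mul, derivative_X, derivative_add, derivative_C, derivative_natCast, derivative_one, one_mul, zero_mul, zero_add, add_zero] at e1
    push_cast at e0 e1 e2 e3 ⊢
    apply mul_left_cancel₀ (X_ne_zero : (Polynomial.X : ℝ[X]) ≠ 0)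
    rw [mul_zero]
    linear_combination Polynomial.X * e1 + ((n : ℝ[X]) + 2 + C α - Polynomial.X) * e0 + (((n : ℝ[X]) + 2) * ((n : ℝ[X]) + 2 + C α)) * e2 +
      (((n : ℝ[X]) + 2) * ((n : ℝ[X]) + 2 + C α)) * e3

/-- **STIELTJES' EQUILIBRIUM FOR THE LAGUERRE ZEROS: `Σ_{j ≠ k} 1∕(x_k − x_j) = (x_k − α − 1)∕(2 x_k)`** at the zeros `0 < x_0 < ⋯ < x_t` of `L_{t+1}^{(α)}`, `α > −1`. [Stieltjes 1885; Szegő Thm 6.7.2;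
this file, §1154] -/
theorem laguerre_zeros_electrostatic {L : ℕ → ℝ[X]} {a b : ℕ → ℝ} {α : ℝ} (hL0 : L 0 = 1) (hL1 : L 1 = Polynomial.X - C (a 0))
    (hLrec : ∀ n, L (n + 2) = (Polynomial.X - C (a (n + 1))) * L (n + 1) - C (b (n + 1)) * L n) (ha : ∀ n, a n = 2 * n + 1 + α)
    (hb : ∀ n, b (n + 1) = ((n : ℝ) + 1) * ((n : ℝ) + 1 + α)) {t : ℕ} {x : Fin (t + 1) → ℝ} (hx : StrictMono x)
    (hxq : L (t + 1) = ∏ k, (Polynomial.X - C (x k))) (hpos : ∀ k, 0 < x k) (k : Fin (t + 1)) :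
    ∑ j ∈ Finset.univ.erase k, (x k - x j)⁻¹ = (x k - α - 1) / (2 * x k) := by
  have hinj := hx.injective
  have hode := congrArg (eval (x k)) (laguerre_differential_equation hL0 hL1 hLrec ha hb (t + 1))
  rw [hxq] at hode
  have hroot : (∏ j, (Polynomial.X - C (x j))).eval (x k) = 0 := by rw [eval_prod]; exact Finset.prod_eq_zero (Finset.mem_univ k) (by simp)
  rw [eval_add, eval_add, eval_mul, eval_mul, eval_mul, eval_sub, eval_X, eval_C, eval_C, hroot, mul_zero, add_zero, eval_zero, ← sum_inv_sub_nodes_eq hinj k] at hode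
  have hder : (derivative (∏ i, (Polynomial.X - C (x i)))).eval (x k) ≠ 0 := by
    rw [eval_derivative_prod_X_sub_C_at_node]
    exact Finset.prod_ne_zero_iff.2 fun j hj => sub_ne_zero.2 fun h => (Finset.mem_erase.1 hj).1 (hinj h).symm
  have hxk := hpos k
  rw [eq_div_iff (by positivity)]
  apply mul_left_cancel₀ hder
  linear_combination hode

end Summit.Ventures.HSemireg.Wedge.HankelOuter
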